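import Summits.Ventures.HSemireg.WedgeHankelClassMapSiegel
import Summits.Ventures.HSemireg.WedgeHankelSiegelIdealSubBox
import Summits.Ventures.HSemireg.WedgeHankelPairKernel
import Summits.Ventures.HSemireg.WedgeHankelSecantKernel

/-!
# Venture HSemireg — THE SUB-BOX CLASSES SPAN A COMPLEMENT OF THE SIEGEL PIECE: for `k ≤ N` and the binomials `C(k,j)` (`j ≤ k`) units in `K`, the classes `w_k(c)` of the first `k`
# pairs form a `(k+1)`-dimensional space (basis: the spike classes `w_k(δ_j)`, `j ≤ k`) meeting `SI_k` in `0`, and **`Hom(Dm k, k) = span{w_k(c)} ⊕ (SI_k ⊓ Hom(Dm k, k))`** —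
# so M8's «the Hankel matrix is the matrix of the class map» speaks for ALL of `Hom(Dm k, k) / SI_k`

HONEST FRAMING. Part of the Lean index of the computation cell `pub-hsemireg` (seat p10 gen 24, Sunday typer «UNIFORM-IN-n»).
Finite-dimensional EXTERIOR ALGEBRA over a field ONLY: no variety, no cohomology theory, no sheaf, no Ext group, no semiregularity map;
nothing here says that HC / HC_CM / HC_AV holds; no Literature fact is declared or used.  Custodian versions as in `WedgeHankelSiegelIdeal` (1/3); dictionary QUOTED, never asserted.

WHAT IS IN THE TREE.  M12 (this seat, `WedgeHankelClassMapSiegel`): `w_mem_siegelIdeal_iff_forall_choose_mul`, `w_sub_mem_siegelIdeal_iff_window_zero`; th-7's linearity `w_add'`, `w_smul'`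
(`WedgeHankelPairKernel` / `…PureKernel`), `w_sum'` (`WedgeHankelSecantKernel`), `w_zero`, `w_eq_of_agree`, `w_mem_Hom`; L1 `Hom_univ_inf_Sp_pairs_eq`; K40 `pr_lt_iff_mem_Dm`; K39 `finrank_Hom_In`,
`card_Dm_eq_two_mul`; L12 (`WedgeHankelSiegelIdealSubBox`): `finrank_siegelIdeal_inf_Sp_pairs_add`; gen 11 `siegelIdeal_le_exteriorPower`, `exteriorPower_eq_Hom_univ`; Mathlib `Fin.card_filter_val_lt`.
THIS FILE (namespace `Summit.Ventures.HSemireg.Wedge.HankelOuter` continued):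
* §423 THE SPACE OF SUB-BOX CLASSES: `w_sub_eq_sum_smul_spike` (`w_k(c) = Σ_{j ≤ k} c_j · w_k(δ_j)`), `exists_eq_w_sub_of_mem_span` (the span of the classes consists of classes),
  `span_w_sub_eq_span_spikes`, **`span_w_sub_inf_siegelIdeal_eq_bot`** (`k!` a unit: the classes meet `SI_k` in `0`), **`linearIndependent_w_sub_spikes`**, **`finrank_span_w_sub`** (`= k + 1`).
* §424 THE COMPLEMENT: `Hom_Dm_eq_Hom_univ_inf_Sp_pairs` (`Hom(Dm k, d) = Hom(univ,d) ⊓ Sp(pairs < k)`), `finrank_siegelIdeal_inf_Hom_Dm_add` (`dim (SI_k ⊓ Hom(Dm k,k)) + (k+1) = C(2k,k)`, every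
  field), **`span_w_sub_sup_siegelIdeal_inf_Hom_Dm`** (`span{w_k(c)} ⊔ (SI_k ⊓ Hom(Dm k,k)) = Hom(Dm k,k)` when the `C(k,j)` are units) — with §423 a direct-sum decomposition.
READING: over a field where `k!` is a unit, every `k`-form on the first `k` pairs is a sub-box class plus a Siegel form, uniquely; the class map of any `w_N(q)` kills the Siegel part and
acts on the class part by the catalecticant `H_k(q)` (M8).  In characteristic `p ≤ k` the classes `w_k(δ_j)` with `p ∣ C(k,j)` fall INTO the Siegel piece (M12) and the complement needs
other forms.  Nothing Ext-side.  New names only.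
-/

open Module

namespace Summit.Ventures.HSemireg.Wedge.HankelOuter

open Summit.Ventures.HSemireg.Wedge Summit.Ventures.HSemireg.Wedge.Kunneth Summit.Ventures.HSemireg.Wedge.Hankel
  Summit.Ventures.HSemireg.Wedge.BasisFree Summit.Ventures.HSemireg.Wedge.HankelSiegel Summit.Ventures.HSemireg.Wedge.HankelSiegelIdeal
  Summit.Ventures.HSemireg.Wedge.KunnethKernel Summit.Ventures.HSemireg.Wedge.HankelFrameChange Summit.Ventures.HSemireg.Wedge.KernelDuality
  Summit.Ventures.HSemireg.Wedge.HankelPureKernel Summit.Ventures.HSemireg.Wedge.HankelSecant Summit.Ventures.HSemireg.Wedge.HankelRankOne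
  Summit.Ventures.HSemireg.Wedge.Weil

variable (K : Type*) [Field K] {N : ℕ}

/-! ## §423. The space of sub-box classes -/

/-- **`w_k(c) = Σ_{j ≤ k} c_j · w_k(δ_j)`** (the class depends only on the window `c_0, …, c_k`, linearly). -/
theorem w_sub_eq_sum_smul_spike (k : ℕ) (c : ℕ → K) :
    w K N k c = ∑ j ∈ Finset.range (k + 1), c j • w K N k (fun i => if i = j then (1 : K) else 0) := by
  have e : ∀ i ≤ k, c i = (∑ j ∈ Finset.range (k + 1), c j • (fun i => if i = j then (1 : K) else 0)) i := by
    intro i hi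
    rw [Finset.sum_apply, Finset.sum_eq_single i]
    · simp only [Pi.smul_apply, if_true, smul_eq_mul, mul_one]
    · intro j _ hj
      simp only [Pi.smul_apply, if_neg (Ne.symm hj), smul_zero]
    · intro h
      exact absurd (Finset.mem_range.mpr (by omega)) h
  rw [w_eq_of_agree K k e, w_sum' K N k]
  exact Finset.sum_congr rfl fun j _ => w_smul' K (c j) k _

/-- the span of the sub-box classes consists of sub-box classes. -/
theorem exists_eq_w_sub_of_mem_span (k : ℕ) {x : HT K (In N)} (hx : x ∈ Submodule.span K (Set.range fun c : ℕ → K => w K N k c)) : ∃ c : ℕ → K, x = w K N k c := by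
  induction hx using Submodule.span_induction with
  | mem x hx =>
    obtain ⟨c, rfl⟩ := hx
    exact ⟨c, rfl⟩
  | zero => exact ⟨fun _ => 0, (w_zero K k).symm⟩
  | add x y _ _ hx hy =>
    obtain ⟨c, rfl⟩ := hx
    obtain ⟨c', rfl⟩ := hy
    exact ⟨c + c', (w_add' K N k c c').symm⟩
  | smul a x _ hx =>
    obtain ⟨c, rfl⟩ := hx
    exact ⟨a • c, (w_smul' K a k c).symm⟩

/-- the classes are spanned by the `k + 1` spike classes: `span{w_k(c) : c} = span{w_k(δ_j) : j ≤ k}`. -/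
theorem span_w_sub_eq_span_spikes (k : ℕ) :
    Submodule.span K (Set.range fun c : ℕ → K => w K N k c) = Submodule.span K (Set.range fun j : Fin (k + 1) => w K N k (fun i => if i = (j : ℕ) then (1 : K) else 0)) := by
  refine le_antisymm ?_ (Submodule.span_mono ?_)
  · rw [Submodule.span_le]
    rintro _ ⟨c, rfl⟩
    rw [SetLike.mem_coe, show (fun c : ℕ → K => w K N k c) c = w K N k c from rfl, w_sub_eq_sum_smul_spike K k c,
      Finset.sum_range (fun j => c j • w K N k (fun i => if i = j then (1 : K) else 0))]
    exact Submodule.sum_mem _ fun j _ => Submodule.smul_mem _ _ (Submodule.subset_span ⟨j, rfl⟩)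
  · rintro _ ⟨j, rfl⟩
    exact ⟨_, rfl⟩

/-- **`k!` a unit: THE SUB-BOX CLASSES MEET THE SIEGEL IDEAL IN `0`: `span{w_k(c)} ⊓ SI_k = ⊥`** (`k ≤ N`, all `C(k,j) ≠ 0` in `K`; M12). -/
theorem span_w_sub_inf_siegelIdeal_eq_bot {k : ℕ} (hk : k ≤ N) (hK : ∀ j ≤ k, (k.choose j : K) ≠ 0) :
    Submodule.span K (Set.range fun c : ℕ → K => w K N k c) ⊓ siegelIdeal K N k = ⊥ := by
  rw [Submodule.eq_bot_iff]
  rintro x ⟨hx, hS⟩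
  obtain ⟨c, rfl⟩ := exists_eq_w_sub_of_mem_span K k hx
  have h0 := (w_sub_mem_siegelIdeal_iff_window_zero K hk hK c).mp hS
  rw [w_eq_of_agree K k (q' := fun _ => (0 : K)) (fun i hi => h0 i hi), w_zero]

/-- **`k!` a unit: the spike classes `w_k(δ_j)`, `j ≤ k`, are linearly independent** (a vanishing combination is a sub-box class in `SI_k`, hence has zero window). -/
theorem linearIndependent_w_sub_spikes {k : ℕ} (hk : k ≤ N) (hK : ∀ j ≤ k, (k.choose j : K) ≠ 0) :
    LinearIndependent K (fun j : Fin (k + 1) => w K N k (fun i => if i = (j : ℕ) then (1 : K) else 0)) := by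
  rw [Fintype.linearIndependent_iff]
  intro a ha j
  let c : ℕ → K := fun i => if h : i < k + 1 then a ⟨i, h⟩ else 0
  have hc : w K N k c = 0 := by
    rw [w_sub_eq_sum_smul_spike K k c, Finset.sum_range (fun j => c j • w K N k (fun i => if i = j then (1 : K) else 0)), ← ha]
    refine Finset.sum_congr rfl fun i _ => ?_
    simp only [c, dif_pos i.2, Fin.eta]
  have hS : w K N k c ∈ siegelIdeal K N k := by rw [hc]; exact Submodule.zero_mem _
  have h0 := (w_sub_mem_siegelIdeal_iff_window_zero K hk hK c).mp hS j (by have := j.2; omega)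
  simp only [c, dif_pos j.2, Fin.eta] at h0
  exact h0

/-- **`k!` a unit: `dim span{w_k(c) : c} = k + 1`.** -/
theorem finrank_span_w_sub {k : ℕ} (hk : k ≤ N) (hK : ∀ j ≤ k, (k.choose j : K) ≠ 0) :
    finrank K ↥(Submodule.span K (Set.range fun c : ℕ → K => w K N k c)) = k + 1 := by
  rw [span_w_sub_eq_span_spikes, finrank_span_eq_card (linearIndependent_w_sub_spikes K hk hK), Fintype.card_fin]

/-! ## §424. The complement -/

/-- `Hom(Dm k, d) = Hom(univ, d) ⊓ Sp(pairs < k)` (the forms on the letters of the first `k` pairs). -/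
theorem Hom_Dm_eq_Hom_univ_inf_Sp_pairs (k d : ℕ) :
    Hom K (In N) (Dm N k) d = Hom K (In N) Finset.univ d ⊓ Sp K (fun s : Finset (In N) => ∀ i ∈ s, pr i ∈ Finset.univ.filter fun c : Fin N => (c : ℕ) < k) := by
  rw [Hom_univ_inf_Sp_pairs_eq]
  congr 1
  ext i
  rw [Finset.mem_filter, Finset.mem_filter, ← pr_lt_iff_mem_Dm]
  simp only [Finset.mem_univ, true_and]

/-- **`dim (SI_k ⊓ Hom(Dm k, k)) + (k + 1) = C(2k, k)`** (`k ≤ N`, every field; L12 on the sub-box of the first `k` pairs). -/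
theorem finrank_siegelIdeal_inf_Hom_Dm_add {k : ℕ} (hk : k ≤ N) :
    finrank K ↥(siegelIdeal K N k ⊓ Hom K (In N) (Dm N k) k) + (k + 1) = (k + k).choose k := by
  have hT : (Finset.univ.filter fun c : Fin N => (c : ℕ) < k).card = k := by rw [Fin.card_filter_val_lt, min_eq_right hk]
  have hSI : siegelIdeal K N k ≤ Hom K (In N) Finset.univ k := by rw [← exteriorPower_eq_Hom_univ]; exact siegelIdeal_le_exteriorPower K k
  rw [Hom_Dm_eq_Hom_univ_inf_Sp_pairs, ← inf_assoc, inf_eq_left.mpr hSI]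
  have h := finrank_siegelIdeal_inf_Sp_pairs_add K (Finset.univ.filter fun c : Fin N => (c : ℕ) < k) k
  rw [hT, Nat.choose_self, mul_one] at h
  exact h

/-- **`k!` a unit: THE SUB-BOX CLASSES SPAN A COMPLEMENT OF THE SIEGEL PIECE: `span{w_k(c)} ⊔ (SI_k ⊓ Hom(Dm k, k)) = Hom(Dm k, k)`** (`k ≤ N`; with §423 the sum is direct). -/
theorem span_w_sub_sup_siegelIdeal_inf_Hom_Dm {k : ℕ} (hk : k ≤ N) (hK : ∀ j ≤ k, (k.choose j : K) ≠ 0) :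
    Submodule.span K (Set.range fun c : ℕ → K => w K N k c) ⊔ (siegelIdeal K N k ⊓ Hom K (In N) (Dm N k) k) = Hom K (In N) (Dm N k) k := by
  have hle : Submodule.span K (Set.range fun c : ℕ → K => w K N k c) ⊔ (siegelIdeal K N k ⊓ Hom K (In N) (Dm N k) k) ≤ Hom K (In N) (Dm N k) k := by
    refine sup_le ?_ inf_le_right
    rw [Submodule.span_le]
    rintro _ ⟨c, rfl⟩
    exact w_mem_Hom K hk c
  have hdisj : Submodule.span K (Set.range fun c : ℕ → K => w K N k c) ⊓ (siegelIdeal K N k ⊓ Hom K (In N) (Dm N k) k) = ⊥ := by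
    rw [← inf_assoc, span_w_sub_inf_siegelIdeal_eq_bot K hk hK, bot_inf_eq]
  apply Submodule.eq_of_le_of_finrank_eq hle
  have h1 := Submodule.finrank_sup_add_finrank_inf_eq (Submodule.span K (Set.range fun c : ℕ → K => w K N k c)) (siegelIdeal K N k ⊓ Hom K (In N) (Dm N k) k)
  rw [hdisj, finrank_bot, add_zero, finrank_span_w_sub K hk hK] at h1
  have h2 := finrank_siegelIdeal_inf_Hom_Dm_add K hk
  rw [finrank_Hom_In, card_Dm_eq_two_mul k hk, two_mul]
  omega

end Summit.Ventures.HSemireg.Wedge.HankelOuter
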